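import Summits.QuantumFields.YangMills.Theorems.ChatterjeeMassGapTorusAxialOneBitBoxIntegral
import HarnessLib

/-!
# Support rigidity for the ADJACENT coplanar plaquette pair — the search device (item 8941 lane)

Seat ym-dw-p1 g7, target T1 of ym-idea-4 g7 (13:41Z): the truncated correlation of the adjacent
coplanar plaquettes `A = P_{0,(0,1)}`, `B = P_{e₀,(0,1)}` (they share the link `(e₀, 1)`), i.e.
the axial two-point function `f_{β,μ}(e₀)` at distance one. Its leading strong-coupling order is
governed by the families of at most ten plaquettes of `ℤ⁴` containing `A, B` WITHOUT private
bonds: they are exactly the four `2×1×1` boxes `[0,2]_0 × [0,1]_1 × I_j`, `j ∈ {2,3}`,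
`I ∈ {[0,1], [-1,0]}` (`…AdjacentPairRigidity`). This file is the definition-free search device
of ym-dw-p1 g6's `…OneBitBoxBranch*` adapted to a FAMILY of admissible end states: the
certificate `GS(𝓑, k, T)` (an explicit `Nat.rec` term: cover some private bond of `T` by every
plaquette containing it; prune when more than `4k` private bonds remain; accept a state without
private bonds iff it is a member of `𝓑`) and its soundness `exists_mem_subset_of_GS`: if
`GS(𝓑, k, T) = true`, every family `T' ⊇ T` without private bonds with `#T' ≤ #T + k` contains a
member of `𝓑`. Pure lattice combinatorics; no statement about Gibbs states; no mass gap claimed.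
-/

noncomputable section

open Finset
open Literature.MathematicalPhysics.QuantumLattice (ZdEdge ZdPlaquette plaquetteEdges plaquettesTouching
  mem_plaquettesTouching_iff)
open Summit.QuantumFields.YangMills.Theorems.S28OneBitBox (lt01 lt02 lt12)

namespace Summit.QuantumFields.YangMills.Theorems.S28AdjacentPair

/-- `0 < 3` in `Fin 4` (plane label of the `(0,3)`-plaquettes). -/
theorem lt03 : ((0 : Fin 4), (3 : Fin 4)).1 < ((0 : Fin 4), (3 : Fin 4)).2 := by decide

/-- `1 < 3` in `Fin 4` (plane label of the `(1,3)`-plaquettes). -/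
theorem lt13 : ((1 : Fin 4), (3 : Fin 4)).1 < ((1 : Fin 4), (3 : Fin 4)).2 := by decide

/-- `2 < 3` in `Fin 4` (plane label of the `(2,3)`-plaquettes). -/
theorem lt23 : ((2 : Fin 4), (3 : Fin 4)).1 < ((2 : Fin 4), (3 : Fin 4)).2 := by decide

/-- Membership in the set of private bonds of a plaquette family. [folklore] -/
theorem mem_PB {T : Finset (ZdPlaquette 4)} {ℓ : ZdEdge 4} :
    ℓ ∈ ((T).biUnion plaquetteEdges).filter (fun ℓ => ((T).filter fun p => ℓ ∈ plaquetteEdges p).card = 1) ↔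
      (∃ p ∈ T, ℓ ∈ plaquetteEdges p) ∧ (T.filter fun p => ℓ ∈ plaquetteEdges p).card = 1 := by
  simp only [Finset.mem_filter, Finset.mem_biUnion]

/-- No private bonds iff every bond of every member lies in another member. [folklore] -/
theorem PB_eq_empty_iff (T : Finset (ZdPlaquette 4)) :
    ((T).biUnion plaquetteEdges).filter (fun ℓ => ((T).filter fun p => ℓ ∈ plaquetteEdges p).card = 1) = ∅ ↔
      ∀ p ∈ T, ∀ ℓ ∈ plaquetteEdges p, ∃ p' ∈ T, p' ≠ p ∧ ℓ ∈ plaquetteEdges p' := by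
  constructor
  · intro h p hp ℓ hℓ
    by_contra hne
    push Not at hne
    have hmem : ℓ ∈ ((T).biUnion plaquetteEdges).filter (fun ℓ => ((T).filter fun p => ℓ ∈ plaquetteEdges p).card =
        1) := by
      rw [mem_PB]
      refine ⟨⟨p, hp, hℓ⟩, ?_⟩
      rw [Finset.card_eq_one]
      refine ⟨p, Finset.eq_singleton_iff_unique_mem.2 ⟨Finset.mem_filter.2 ⟨hp, hℓ⟩, fun p' hp' => ?_⟩⟩
      obtain ⟨hp'T, hℓp'⟩ := Finset.mem_filter.1 hp'
      by_contra hne'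
      exact hne p' hp'T hne' hℓp'
    rw [h] at hmem
    simp at hmem
  · intro h
    rw [Finset.eq_empty_iff_forall_notMem]
    intro ℓ hℓ
    rw [mem_PB] at hℓ
    obtain ⟨⟨p, hp, hℓp⟩, hcard⟩ := hℓ
    obtain ⟨p', hp'T, hne, hℓp'⟩ := h p hp ℓ hℓp
    have h2 : 2 ≤ (T.filter fun q => ℓ ∈ plaquetteEdges q).card := by
      have hsub : ({p, p'} : Finset (ZdPlaquette 4)) ⊆ T.filter fun q => ℓ ∈ plaquetteEdges q := by
        intro q hq
        rcases Finset.mem_insert.1 hq with rfl | hq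
        · exact Finset.mem_filter.2 ⟨hp, hℓp⟩
        · rw [Finset.mem_singleton] at hq; subst hq; exact Finset.mem_filter.2 ⟨hp'T, hℓp'⟩
      calc 2 = ({p, p'} : Finset (ZdPlaquette 4)).card := (Finset.card_pair hne.symm).symm
        _ ≤ _ := Finset.card_le_card hsub
    omega

/-- Covering: if `T ⊆ T'` and `T'` has no private bonds, every private bond of `T` lies in a
plaquette of `T' ∖ T`. [folklore] -/
theorem exists_mem_sdiff_of_mem_PB {T T' : Finset (ZdPlaquette 4)} (hTT' : T ⊆ T')
    (hN : ((T').biUnion plaquetteEdges).filter (fun ℓ => ((T').filter fun p => ℓ ∈ plaquetteEdges p).card = 1) = ∅)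
    {ℓ : ZdEdge 4} (hℓ : ℓ ∈ ((T).biUnion plaquetteEdges).filter (fun ℓ => ((T).filter fun p => ℓ ∈ plaquetteEdges p).card = 1)) :
    ∃ p'' ∈ T' \ T, ℓ ∈ plaquetteEdges p'' := by
  rw [mem_PB] at hℓ
  obtain ⟨⟨p, hp, hℓp⟩, hcard⟩ := hℓ
  rw [PB_eq_empty_iff] at hN
  obtain ⟨p', hp'T', hne, hℓp'⟩ := hN p (hTT' hp) ℓ hℓp
  refine ⟨p', Finset.mem_sdiff.2 ⟨hp'T', fun hp'T => ?_⟩, hℓp'⟩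
  rw [Finset.card_eq_one] at hcard
  obtain ⟨a, ha⟩ := hcard
  have h1 : p ∈ ({a} : Finset (ZdPlaquette 4)) := ha ▸ Finset.mem_filter.2 ⟨hp, hℓp⟩
  have h2 : p' ∈ ({a} : Finset (ZdPlaquette 4)) := ha ▸ Finset.mem_filter.2 ⟨hp'T, hℓp'⟩
  rw [Finset.mem_singleton] at h1 h2
  exact hne (h2.trans h1.symm)

/-- Counting: if `T ⊆ T'` and `T'` has no private bonds, `T` has at most `4 · #(T' ∖ T)` private
bonds. [folklore] -/
theorem card_PB_le {T T' : Finset (ZdPlaquette 4)} (hTT' : T ⊆ T')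
    (hN : ((T').biUnion plaquetteEdges).filter (fun ℓ => ((T').filter fun p => ℓ ∈ plaquetteEdges p).card = 1) = ∅) :
    (((T).biUnion plaquetteEdges).filter (fun ℓ => ((T).filter fun p => ℓ ∈ plaquetteEdges p).card = 1)).card ≤ 4 *
        (T' \ T).card := by
  classical
  have hsub : ((T).biUnion plaquetteEdges).filter (fun ℓ => ((T).filter fun p => ℓ ∈ plaquetteEdges p).card = 1) ⊆
      (T' \ T).biUnion plaquetteEdges := fun ℓ hℓ => by
    obtain ⟨p'', hp'', hℓp''⟩ := exists_mem_sdiff_of_mem_PB hTT' hN hℓ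
    exact Finset.mem_biUnion.2 ⟨p'', hp'', hℓp''⟩
  refine (Finset.card_le_card hsub).trans ((Finset.card_biUnion_le).trans ?_)
  calc ∑ p ∈ T' \ T, (plaquetteEdges p).card ≤ ∑ _p ∈ T' \ T, 4 :=
        Finset.sum_le_sum fun p _ => Finset.card_le_four
    _ = 4 * (T' \ T).card := by rw [Finset.sum_const, smul_eq_mul, mul_comm]

/-- **Soundness of the search certificate with a family `𝓑` of admissible end states.** If
`GS(𝓑, k, T) = true`, every family `T' ⊇ T` without private bonds and with at most `#T + k`
members contains some member of `𝓑`. [folklore] -/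
theorem exists_mem_subset_of_GS (𝓑 : Finset (Finset (ZdPlaquette 4))) :
    ∀ (k : ℕ) (T : Finset (ZdPlaquette 4)),
      @Nat.rec (fun _ => Finset (ZdPlaquette 4) → Bool)
        (fun T => if ((T).biUnion plaquetteEdges).filter (fun ℓ => ((T).filter fun p => ℓ ∈ plaquetteEdges p).card =
            1) = ∅ then decide (T ∈ 𝓑) else true)
        (fun k ih T => if ((T).biUnion plaquetteEdges).filter (fun ℓ => ((T).filter fun p => ℓ ∈ plaquetteEdges p).card = 1) = ∅ then decide (T ∈ 𝓑)
          else decide (4 * (k + 1) < (((T).biUnion plaquetteEdges).filter (fun ℓ => ((T).filter fun p => ℓ ∈ plaquetteEdges p).card = 1)).card) ||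
            decide (∃ ℓ ∈ ((T).biUnion plaquetteEdges).filter (fun ℓ => ((T).filter fun p => ℓ ∈ plaquetteEdges p).card = 1), ∀ p' ∈ plaquettesTouching {ℓ}, p' ∉ T → ih (insert p' T) = true))
        (k) (T) = true →
      ∀ T' : Finset (ZdPlaquette 4), T ⊆ T' → T'.card ≤ T.card + k →
        ((T').biUnion plaquetteEdges).filter (fun ℓ => ((T').filter fun p => ℓ ∈ plaquetteEdges p).card = 1) =
            ∅ → ∃ B ∈ 𝓑, B ⊆ T' := by
  classical
  intro k
  induction k with
  | zero =>
    intro T hg T' hTT' hcard hN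
    simp only [Nat.rec_zero] at hg
    by_cases h0 : ((T).biUnion plaquetteEdges).filter (fun ℓ => ((T).filter fun p => ℓ ∈ plaquetteEdges p).card =
        1) = ∅
    · simp only [h0, ↓reduceIte, decide_eq_true_eq] at hg
      exact ⟨T, hg, hTT'⟩
    · obtain ⟨ℓ, hℓ⟩ := Finset.nonempty_iff_ne_empty.2 h0
      obtain ⟨p'', hp'', -⟩ := exists_mem_sdiff_of_mem_PB hTT' hN hℓ
      have : (T' \ T).card = 0 := by
        rw [Finset.card_sdiff_of_subset hTT']; omega
      rw [Finset.card_eq_zero] at this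
      rw [this] at hp''
      simp at hp''
  | succ k ih =>
    intro T hg T' hTT' hcard hN
    by_cases h0 : ((T).biUnion plaquetteEdges).filter (fun ℓ => ((T).filter fun p => ℓ ∈ plaquetteEdges p).card =
        1) = ∅
    · simp only [h0, ↓reduceIte, decide_eq_true_eq] at hg
      exact ⟨T, hg, hTT'⟩
    · simp only [h0, ↓reduceIte, Bool.or_eq_true, decide_eq_true_eq] at hg
      have hsd : (T' \ T).card ≤ k + 1 := by
        rw [Finset.card_sdiff_of_subset hTT']; omega
      rcases hg with hbig | ⟨ℓ, hℓ, hstep⟩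
      · have := card_PB_le hTT' hN
        omega
      · obtain ⟨p'', hp'', hℓp''⟩ := exists_mem_sdiff_of_mem_PB hTT' hN hℓ
        obtain ⟨hp''T', hp''T⟩ := Finset.mem_sdiff.1 hp''
        have htouch : p'' ∈ plaquettesTouching ({ℓ} : Finset (ZdEdge 4)) :=
          mem_plaquettesTouching_iff.2 ⟨ℓ, Finset.mem_inter.2 ⟨hℓp'', Finset.mem_singleton_self _⟩⟩
        have hg' := hstep p'' htouch hp''T
        refine ih (insert p'' T) hg' T' (Finset.insert_subset hp''T' hTT') ?_ hN
        rw [Finset.card_insert_of_notMem hp''T]; omega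

end Summit.QuantumFields.YangMills.Theorems.S28AdjacentPair

end
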